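import Summits.CriticalPhenomena.PercolationContinuityZ3.Theorems.PercNearOneGluingNoHeavyLowerTailCubicThreePointShadowHub
import Mathlib.Tactic.Ring
import Mathlib.Tactic.Linarith
import Mathlib.Tactic.Positivity
import HarnessLib

/-!
# `NoHeavyLowerTail` (stmt-CriticalPhenomena-4575) — shadow form of the sharp cubic row: the terminal moves (algebraic form of the exact one-edge formulas)

Support file (prover prim-gen-kcluster gen 14; `--supports stmt-CriticalPhenomena-4575`).  Pure real algebra, no sorries; companion of `…CubicThreePointShadowHub`
(hub gluing) and `…CubicThreePointShadowParallel` (parallel composition).  Memo run/shared/lean/prim/prim-gen-kcluster/W-SHADOW.md, Theorem 3.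

With `S = Ha − (t−q)·X` the shadow slack of a weighted 3-terminal graph `G₀` (law `(q,ua,ub,uc,t)`, shadow mass `X = X_a`, `Y = AG − X`), the memo proves the EXACT formulas
  `S(G₀ + ab(p)) = (1−p)·[(1−p)·S + p·(1−d_c)·Y]`,  `S(G₀ + ac(p)) = (1−p)·[(1−p)·S + p·(1−d_b)·Y]`,  `S(G₀ + bc(p)) = (1−p)²·[S + p·(1−a_a)·Y]`,
  a pendant (`G = G′` plus a new terminal `a` hanging off the old one with weight `p`):  `S(G) = p·[p·S′ + (1−p)·(1−a_a′)·X′]`,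
  b pendant:  `S(G) = p²·[p·S″ + (1−p)·(Ha″ + (1−a_b″)·X″)]`  (c pendant: `b ↔ c`),
(`d_x = q+u_x`, `a_x = t+u_x`; two-copy bookkeeping of the shadow event, verified against brute-force enumeration).  This file records the (elementary) positivity of the
right-hand sides under `W_a` (`S ≥ 0`), `0 ≤ X ≤ AG` and the simplex constraints: Conjecture W_a is preserved by adding terminal–terminal edges of any weight and by pendant
moves at any terminal — the "series" half of the terminal-series-parallel closure whose "parallel" half is `CubicThreePointShadow.parS_nonneg`.
[cite: Gladkov2024StrongFKG, Cor. 4.2 (AG ≥ 0)]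
-/

namespace Summit.CriticalPhenomena.PercolationContinuityZ3.Theorems

namespace CubicThreePointShadow

open CubicThreePointTerminal

/-- Terminal edge `ab` of weight `p`: the new shadow slack `(1−p)[(1−p)S + p(1−d_c)Y]` is nonnegative. [conjecture-support: closure step of W_a] -/
theorem move_ab_nonneg (q ua ub uc t X p : ℝ) (hua : 0 ≤ ua) (hub : 0 ≤ ub) (ht : 0 ≤ t)
    (hσ : q + ua + ub + uc + t = 1) (hAX : 0 ≤ AG q ua ub uc t - X) (hW : 0 ≤ Ha q ua ub uc t - (t - q) * X)
    (hp0 : 0 ≤ p) (hp1 : 0 ≤ 1 - p) :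
    0 ≤ (1 - p) * ((1 - p) * (Ha q ua ub uc t - (t - q) * X) + p * (1 - (q + uc)) * (AG q ua ub uc t - X)) := by
  have hdc : 0 ≤ 1 - (q + uc) := by linarith
  exact mul_nonneg hp1 (add_nonneg (mul_nonneg hp1 hW) (mul_nonneg (mul_nonneg hp0 hdc) hAX))

/-- Terminal edge `ac` of weight `p`: `(1−p)[(1−p)S + p(1−d_b)Y] ≥ 0`. [conjecture-support: closure step of W_a] -/
theorem move_ac_nonneg (q ua ub uc t X p : ℝ) (hua : 0 ≤ ua) (huc : 0 ≤ uc) (ht : 0 ≤ t)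
    (hσ : q + ua + ub + uc + t = 1) (hAX : 0 ≤ AG q ua ub uc t - X) (hW : 0 ≤ Ha q ua ub uc t - (t - q) * X)
    (hp0 : 0 ≤ p) (hp1 : 0 ≤ 1 - p) :
    0 ≤ (1 - p) * ((1 - p) * (Ha q ua ub uc t - (t - q) * X) + p * (1 - (q + ub)) * (AG q ua ub uc t - X)) := by
  have hdb : 0 ≤ 1 - (q + ub) := by linarith
  exact mul_nonneg hp1 (add_nonneg (mul_nonneg hp1 hW) (mul_nonneg (mul_nonneg hp0 hdb) hAX))

/-- Terminal edge `bc` of weight `p`: `(1−p)²[S + p(1−a_a)Y] ≥ 0`. [conjecture-support: closure step of W_a] -/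
theorem move_bc_nonneg (q ua ub uc t X p : ℝ) (hq : 0 ≤ q) (hub : 0 ≤ ub) (huc : 0 ≤ uc)
    (hσ : q + ua + ub + uc + t = 1) (hAX : 0 ≤ AG q ua ub uc t - X) (hW : 0 ≤ Ha q ua ub uc t - (t - q) * X)
    (hp0 : 0 ≤ p) :
    0 ≤ (1 - p) ^ 2 * ((Ha q ua ub uc t - (t - q) * X) + p * (1 - (t + ua)) * (AG q ua ub uc t - X)) := by
  have haa : 0 ≤ 1 - (t + ua) := by linarith
  exact mul_nonneg (sq_nonneg _) (add_nonneg hW (mul_nonneg (mul_nonneg hp0 haa) hAX))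

/-- Pendant move at `a` (new terminal `a` attached with weight `p` to the old `a` of `G′`, law/shadow `(q,ua,ub,uc,t)`, `X` of `G′`):
`p[pS′ + (1−p)(1−a_a′)X′] ≥ 0`. [conjecture-support: closure step of W_a] -/
theorem move_pendant_a_nonneg (q ua ub uc t X p : ℝ) (hq : 0 ≤ q) (hub : 0 ≤ ub) (huc : 0 ≤ uc) (hX : 0 ≤ X)
    (hσ : q + ua + ub + uc + t = 1) (hW : 0 ≤ Ha q ua ub uc t - (t - q) * X) (hp0 : 0 ≤ p) (hp1 : 0 ≤ 1 - p) :
    0 ≤ p * (p * (Ha q ua ub uc t - (t - q) * X) + (1 - p) * (1 - (t + ua)) * X) := by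
  have haa : 0 ≤ 1 - (t + ua) := by linarith
  exact mul_nonneg hp0 (add_nonneg (mul_nonneg hp0 hW) (mul_nonneg (mul_nonneg hp1 haa) hX))

/-- Pendant move at `b` (new terminal `b` attached with weight `p` to the old `b` of `G″`): `p²[pS″ + (1−p)(Ha″ + (1−a_b″)X″)] ≥ 0`, using `W_a(G″)` in the form
`Ha″ ≥ (t″−q″)X″` and `t″ − q″ ≥ −(1 − a_b″)`. [conjecture-support: closure step of W_a] -/
theorem move_pendant_b_nonneg (q ua ub uc t X p : ℝ) (hua : 0 ≤ ua) (huc : 0 ≤ uc) (ht : 0 ≤ t) (hX : 0 ≤ X)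
    (hσ : q + ua + ub + uc + t = 1) (hW : 0 ≤ Ha q ua ub uc t - (t - q) * X) (hp0 : 0 ≤ p) (hp1 : 0 ≤ 1 - p) :
    0 ≤ p ^ 2 * (p * (Ha q ua ub uc t - (t - q) * X) + (1 - p) * (Ha q ua ub uc t + (1 - (t + ub)) * X)) := by
  have h1 : 0 ≤ Ha q ua ub uc t + (1 - (t + ub)) * X := by nlinarith
  exact mul_nonneg (sq_nonneg _) (add_nonneg (mul_nonneg hp0 hW) (mul_nonneg hp1 h1))

/-- Pendant move at `c`: `p²[pS″ + (1−p)(Ha″ + (1−a_c″)X″)] ≥ 0`. [conjecture-support: closure step of W_a] -/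
theorem move_pendant_c_nonneg (q ua ub uc t X p : ℝ) (hua : 0 ≤ ua) (hub : 0 ≤ ub) (ht : 0 ≤ t) (hX : 0 ≤ X)
    (hσ : q + ua + ub + uc + t = 1) (hW : 0 ≤ Ha q ua ub uc t - (t - q) * X) (hp0 : 0 ≤ p) (hp1 : 0 ≤ 1 - p) :
    0 ≤ p ^ 2 * (p * (Ha q ua ub uc t - (t - q) * X) + (1 - p) * (Ha q ua ub uc t + (1 - (t + uc)) * X)) := by
  have h1 : 0 ≤ Ha q ua ub uc t + (1 - (t + uc)) * X := by nlinarith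
  exact mul_nonneg (sq_nonneg _) (add_nonneg (mul_nonneg hp0 hW) (mul_nonneg hp1 h1))

end CubicThreePointShadow

end Summit.CriticalPhenomena.PercolationContinuityZ3.Theorems
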